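import Literature.Probability.RandomPlanarGeometry.HexSAWArmchairUnfoldingStep
import Literature.Probability.RandomPlanarGeometry.HexSAWSurfaceWallBridges
import Literature.Probability.RandomPlanarGeometry.HexSAWBrickWallSlabLocality
import HarnessLib

/-!
# The armchair wall-bridge rate dominates the connective constant: `μ ≤ β_rot(y)` for EVERY `y > 0`
# (given the unfolding face «ARM-ARCH-BOUND»), hence Beaton's `μ(y) = lim U⁺_n(y)^{1/n}` with the value `β_rot(y)` itself

Topic `Literature/Probability/RandomPlanarGeometry` (lane «pcv-sawmu», door «HEX-YC-ROT-LIMIT-ALL-Y», rider H «ARM-RATE-EQ»; continues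
`HexSAWArmchairWallBridges.lean` — `hp`, `arches`, `visits`, `Aw`, `armRate`, the face `ArchBound` — and uses
`HexSAWArmchairUnfoldingStep.lean` (`visits_eq_card`), the DCS-frame wall file `HexSAWSurfaceWallBridges.lean` (the two-sided
column unfolding `Wall.G`, `Wall.G_spec`, `Wall.card_le_exp_mul_card_image_G`) and `HexSAWBrickWallSlabLocality.lean` (up-walks
`HexBW.upWalks`, `hvBridgeLen_le_card_upWalks`, with `HV.eventually_pow_le_hvBridgeLen`).

Sources.  J. M. Hammersley, G. M. Torrie, S. G. Whittington, *Self-avoiding walks interacting with a surface*, J. Phys. A 15 (1982)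
539, §2 (walks, unfolded walks and walks terminally attached to the surface have the same free energy); N. R. Beaton, J. Phys. A 47
(2014) 075003, arXiv:1210.0274v3, §3.1, proof of Proposition 7 (p. 12: "the proof of [HTW] can be applied mutatis mutandis to show
that `μ(y) = lim_{n→∞} U_n^+(y)^{1/n}` exists"; "we obviously have `U^+_n(y) ≤ C^+_n(y)`"); N. Madras, G. Slade, *The Self-Avoiding
Walk* (1993), §3.1 (Hammersley–Welsh unfolding, proof of Theorem 3.1.1) and §8.2 (proof of Theorem 8.2.1, p. 269: concatenation of
bridges with a reflected copy); H. Duminil-Copin, S. Smirnov, Ann. of Math. 175 (2012) 1653, Theorem 1.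

## The argument (armchair frame; the wall is the column `X = 0`, wall bridges climb the rows `Y`)

Two INDEPENDENT column-unfolded up-walks `ω₁, ω₂` of `N` steps with the same end column `h` are glued into ONE arch of
`2N + 4` steps with exactly three wall visits: `0 → (0,1) → (1,1) + ω₁ → one vertical bond → the row-mirrored reversal of
`(1,·) + ω₂ → (0, r)`.  The first block lies in the rows `≤ 1 + T₁`, the second in the rows `≥ 2 + T₁`, both in the columns
`≥ 1`; the vertical bond at the junction exists because the end of a `2k`-step brick-wall walk from `0` has even parity, and the
mirror `Y ↦ r − Y`, `r = T₁ + T₂ + 2`, composed with the unit column shift is a brick-wall map because `T₁ ≡ h ≡ T₂ (mod 2)`.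
Hence `A_{2N+4}(y) ≥ y³ · F²` with `F` the largest end-column fibre of the unfolded up-walks, `F ≥ e^{−6√N} #upWalks(N−2)/(N+1)`,
and `#upWalks (2m) ≥ b_{2m}(ℍ) ≥ τ^{2m}` eventually for every `τ < μ` (Duminil-Copin–Smirnov bridges by length).  With the face
`ArchBound y` (`A_n(y) ≤ C rⁿ` for `r > β_rot(y)`) this forces `τ ≤ r`, i.e. **`μ ≤ β_rot(y)`**.

## Main statements (namespace `…SAW.HexBW.Arm`)

* `liftUp`, `liftUp_mem_saws`, `glue`, `glue_mem_arches`, `visits_glue` — the gluing;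
* `sq_le_Aw` — `y³ · (#S)² ≤ A_{2N+4}(y)` for an end-column fibre `S`;
* **`hexConnectiveConstant_le_armRate_of_archBound (hy : 0 < y) (hA : ArchBound y) : hexConnectiveConstant ≤ armRate y`**,
  `max_armRate_eq_of_archBound : max (armRate y) hexConnectiveConstant = armRate y`.

EDITION ed.2 (a-p6 g11, 2026-08-23): `zero_eq_pt` made `private` — the gate's statement-level `dedup.landed` lint matched it textually with
`Literature.Probability.Percolation.zero_eq_pt` of `ZdEdgeFourArmRerooting.lean` (a different `pt`; nothing to reuse); no other change.
-/

noncomputable section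

open Finset Filter Function
open Literature.Probability.LatticeModels Literature.Probability.Percolation SimpleGraph
open _root_.Topology

namespace Literature.Probability.RandomPlanarGeometry.SAW.HexBW.Arm

variable {y : ℝ} {n N : ℕ} {ω : ℕ → Site 2}

/-! ### (0) Three explicit brick-wall bonds -/

/-- `(a, b) — (a+1, b)`. [cite: EntingJensen2009, §7.4.2, Fig. 7.10 (brickwork form of the honeycomb lattice)] -/
theorem adj_pt_right (a b : ℤ) : brickWallGraph.Adj (pt a b) (pt (a + 1) b) :=
  (brickWallGraph_adj_coord _ _).2 (Or.inl ⟨Or.inl (by simp), by simp⟩)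

/-- `(a+1, b) — (a, b)`. [cite: EntingJensen2009, §7.4.2, Fig. 7.10 (brickwork form of the honeycomb lattice)] -/
theorem adj_pt_left (a b : ℤ) : brickWallGraph.Adj (pt (a + 1) b) (pt a b) := (adj_pt_right a b).symm

/-- `(a, b) — (a, b+1)` when `a + b` is even. [cite: EntingJensen2009, §7.4.2, Fig. 7.10 (brickwork form of the honeycomb lattice)] -/
theorem adj_pt_up {a b : ℤ} (h : (a + b) % 2 = 0) : brickWallGraph.Adj (pt a b) (pt a (b + 1)) :=
  (brickWallGraph_adj_coord _ _).2 (Or.inr ⟨by simp, Or.inl ⟨by simp, by simpa using h⟩⟩)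

/-- `0 = (0, 0)`. [cite: EntingJensen2009, §7.4.2, Fig. 7.10 (brickwork form of the honeycomb lattice)] -/
private theorem zero_eq_pt : (0 : Site 2) = pt 0 0 := by rw [site_two_eq_iff]; simp

/-! ### (1) Up-walks re-based at the wall vertex `0` -/

/-- An up-walk shape `υ` (placed at the odd site `e = (1,0)`) re-based at the wall vertex `0`: the vertical bond `0 → (0,1)`, the
shape translated to `(0,1) = e + (−1,1)`, and one final horizontal step to the right (to make the length even).
[cite: MadrasSlade1993, §8.2, proof of Theorem 8.2.1 (p. 269)] -/
def liftUp (n : ℕ) (υ : ℕ → Site 2) : ℕ → Site 2 := fun i =>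
  if i = 0 then 0 else if i ≤ n + 1 then pt (υ (i - 1) 0) (υ (i - 1) 1 + 1) else pt (υ n 0 + 1) (υ n 1 + 1)

/-- `liftUp n υ 0 = 0`. [cite: MadrasSlade1993, §1.1] -/
theorem liftUp_zero (n : ℕ) (υ : ℕ → Site 2) : liftUp n υ 0 = 0 := by simp [liftUp]

/-- The middle values. [cite: MadrasSlade1993, §1.1] -/
theorem liftUp_of_le (υ : ℕ → Site 2) {i : ℕ} (h1 : 1 ≤ i) (h2 : i ≤ n + 1) :
    liftUp n υ i = pt (υ (i - 1) 0) (υ (i - 1) 1 + 1) := by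
  simp only [liftUp, if_neg (show i ≠ 0 by omega), if_pos h2]

/-- The frozen tail. [cite: MadrasSlade1993, §1.1] -/
theorem liftUp_of_ge (υ : ℕ → Site 2) {i : ℕ} (h : n + 2 ≤ i) : liftUp n υ i = pt (υ n 0 + 1) (υ n 1 + 1) := by
  simp only [liftUp, if_neg (show i ≠ 0 by omega), if_neg (show ¬ i ≤ n + 1 by omega)]

/-- **The re-based up-walk is a brick-wall SAW from `0` with `n + 2` steps**, its rows lie in `[0, T+1]` with `T+1` the final row,
and row `0` is left at once. [cite: MadrasSlade1993, §8.2, proof of Theorem 8.2.1 (p. 269); EntingJensen2009, §7.4.2, Fig. 7.10] -/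
theorem liftUp_mem_saws {υ : ℕ → Site 2} (hυ : υ ∈ upWalks n) :
    liftUp n υ ∈ saws (n + 2) ∧ (∀ i ≤ n + 2, liftUp n υ i 1 ≤ liftUp n υ (n + 2) 1) ∧
      liftUp n υ (n + 2) 1 = υ n 1 + 1 := by
  obtain ⟨hs, hbw, hrow⟩ := mem_upWalks.1 hυ
  obtain ⟨h0, -, -, hinj⟩ := Zd.mem_saws.1 hs
  have h00 : υ 0 0 = 0 := by rw [h0]; rfl
  have h01 : υ 0 1 = 0 := by rw [h0]; rfl
  have hrow' : ∀ i ≤ n, 0 ≤ υ i 1 ∧ υ i 1 ≤ υ n 1 := fun i hi =>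
    ⟨upWalks_row_nonneg hυ hi, upWalks_row_le_last hυ hi⟩
  have hend : liftUp n υ (n + 2) 1 = υ n 1 + 1 := by rw [liftUp_of_ge υ le_rfl, pt_apply_one]
  refine ⟨mem_saws_iff.2 ⟨liftUp_zero n υ, fun i hi => ?_, fun i hi => ?_, ?_⟩, fun i hi => ?_, hend⟩
  · rw [liftUp_of_ge υ hi, liftUp_of_ge υ le_rfl]
  · -- bonds
    rcases Nat.eq_zero_or_pos i with rfl | hi1
    · rw [liftUp_zero, liftUp_of_le υ le_rfl (by omega), show 0 + 1 - 1 = 0 from rfl, h00, h01, zero_add, zero_eq_pt]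
      exact adj_pt_up (by decide)
    rcases Nat.lt_or_ge i (n + 1) with hin | hin
    · have hb := hbw (i - 1) (by omega)
      rw [brickWallGraph_adj_coord] at hb
      simp only [Pi.add_apply, bwE_apply_zero, bwE_apply_one, show i - 1 + 1 = i by omega] at hb
      rw [liftUp_of_le υ hi1 (by omega), liftUp_of_le υ (by omega) (by omega), brickWallGraph_adj_coord]
      simp only [pt_apply_zero, pt_apply_one, show i + 1 - 1 = i by omega]
      omega
    · obtain rfl : i = n + 1 := by omega
      rw [liftUp_of_le υ hi1 le_rfl, liftUp_of_ge υ le_rfl, Nat.add_sub_cancel]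
      exact adj_pt_right _ _
  · -- injective
    intro i hi j hj hij
    simp only [Set.mem_setOf_eq] at hi hj
    have key : ∀ a b : ℕ, a ≤ n + 2 → b ≤ n + 2 → a < b → liftUp n υ a = liftUp n υ b → False := by
      intro a b ha hb hab he
      have he0 := congrFun he 0
      have he1 := congrFun he 1
      rcases Nat.eq_zero_or_pos a with rfl | ha1
      · rw [liftUp_zero] at he1
        rcases Nat.lt_or_ge b (n + 2) with hb' | hb'
        · rw [liftUp_of_le υ (by omega) (by omega), pt_apply_one] at he1
          have := (hrow' (b - 1) (by omega)).1; simp at he1; omega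
        · rw [liftUp_of_ge υ hb', pt_apply_one] at he1
          have := (hrow' n le_rfl).1; simp at he1; omega
      rcases Nat.lt_or_ge b (n + 2) with hb' | hb'
      · rw [liftUp_of_le υ ha1 (by omega), liftUp_of_le υ (by omega) (by omega)] at he0 he1
        simp only [pt_apply_zero, pt_apply_one] at he0 he1
        have : υ (a - 1) = υ (b - 1) := by
          rw [site_two_eq_iff]; exact ⟨he0, by omega⟩
        have := hinj (show a - 1 ∈ {i | i ≤ n} by simp; omega) (show b - 1 ∈ {i | i ≤ n} by simp; omega) this
        omega
      · obtain rfl : b = n + 2 := by omega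
        rw [liftUp_of_le υ ha1 (by omega), liftUp_of_ge υ le_rfl] at he0 he1
        simp only [pt_apply_zero, pt_apply_one] at he0 he1
        rcases Nat.lt_or_ge a (n + 1) with ha' | ha'
        · have := (hrow (a - 1) (by omega)).2; omega
        · obtain rfl : a = n + 1 := by omega
          simp at he0
    rcases lt_trichotomy i j with h | h | h
    · exact (key i j hi hj h hij).elim
    · exact h
    · exact (key j i hj hi h hij.symm).elim
  · -- rows below the last
    rw [hend]
    rcases Nat.eq_zero_or_pos i with rfl | hi1
    · rw [liftUp_zero]; have := (hrow' n le_rfl).1; simp; omega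
    rcases Nat.lt_or_ge i (n + 2) with hi' | hi'
    · rw [liftUp_of_le υ hi1 (by omega), pt_apply_one]; have := (hrow' (i - 1) (by omega)).2; omega
    · rw [liftUp_of_ge υ hi', pt_apply_one]

/-- `liftUp n` is injective on up-walks. [cite: MadrasSlade1993, §1.1] -/
theorem liftUp_injOn (n : ℕ) : Set.InjOn (liftUp n) ↑(upWalks n) := by
  intro υ hυ υ' hυ' h
  obtain ⟨hs, -, -⟩ := mem_upWalks.1 (show υ ∈ upWalks n from hυ)
  obtain ⟨hs', -, -⟩ := mem_upWalks.1 (show υ' ∈ upWalks n from hυ')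
  obtain ⟨-, hend, -, -⟩ := Zd.mem_saws.1 hs
  obtain ⟨-, hend', -, -⟩ := Zd.mem_saws.1 hs'
  funext i
  rcases Nat.lt_or_ge n i with hi | hi
  · rw [hend i hi.le, hend' i hi.le]
    have h1 := congrFun h (n + 1)
    rw [liftUp_of_le υ (by omega) le_rfl, liftUp_of_le υ' (by omega) le_rfl, Nat.add_sub_cancel] at h1
    rw [site_two_eq_iff] at h1 ⊢; simp only [pt_apply_zero, pt_apply_one] at h1; omega
  · have h1 := congrFun h (i + 1)
    rw [liftUp_of_le υ (by omega) (by omega), liftUp_of_le υ' (by omega) (by omega), Nat.add_sub_cancel] at h1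
    rw [site_two_eq_iff] at h1 ⊢; simp only [pt_apply_zero, pt_apply_one] at h1; omega


/-! ### (2) Pieces and the gluing of two pieces into one arch with three wall visits -/

/-- A **piece**: a brick-wall SAW from `0` with `N` steps in the quadrant `X ≥ 0`, never above its final row, ending in column `h`.
[cite: HammersleyTorrieWhittington1982, §2 (unfolded walks); MadrasSlade1993, §3.1] -/
def IsPiece (N : ℕ) (h : ℤ) (ω : ℕ → Site 2) : Prop :=
  ω ∈ saws N ∧ (∀ i ≤ N, 0 ≤ ω i 0 ∧ ω i 1 ≤ ω N 1) ∧ ω N 0 = h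

/-- Translation by `(1, 1)` preserves brick-wall bonds. [cite: EntingJensen2009, §7.4.2, Fig. 7.10 (brickwork form of the honeycomb lattice)] -/
theorem adj_pt_shift {x z : Site 2} (h : brickWallGraph.Adj x z) :
    brickWallGraph.Adj (pt (x 0 + 1) (x 1 + 1)) (pt (z 0 + 1) (z 1 + 1)) := by
  rw [brickWallGraph_adj_coord] at h ⊢
  simp only [pt_apply_zero, pt_apply_one]
  omega

/-- The row mirror `Y ↦ r − Y`, `r` even, composed with the unit column shift preserves brick-wall bonds.
[cite: EntingJensen2009, §7.4.2, Fig. 7.10 (brickwork form of the honeycomb lattice)] -/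
theorem adj_pt_mirror {r : ℤ} (hr : r % 2 = 0) {x z : Site 2} (h : brickWallGraph.Adj x z) :
    brickWallGraph.Adj (pt (x 0 + 1) (r - x 1)) (pt (z 0 + 1) (r - z 1)) := by
  rw [brickWallGraph_adj_coord] at h ⊢
  simp only [pt_apply_zero, pt_apply_one]
  omega

/-- **The glued arch** of two pieces `ω₁, ω₂` with `N` steps each (`2N + 4` steps): `0 → (0,1) → (1,1) + ω₁ →` one vertical bond `→` the
row-mirrored reversal of `(1,·) + ω₂ → (0, r)`, `r = T₁ + T₂ + 2`.
[cite: HammersleyTorrieWhittington1982, §2; MadrasSlade1993, §8.2, proof of Theorem 8.2.1 (p. 269: a bridge followed by a reflected bridge)] -/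
def glue (N : ℕ) (ω₁ ω₂ : ℕ → Site 2) : ℕ → Site 2 := fun i =>
  if i = 0 then 0 else if i = 1 then pt 0 1 else
  if i ≤ N + 2 then pt (ω₁ (i - 2) 0 + 1) (ω₁ (i - 2) 1 + 1) else
  if i ≤ 2 * N + 3 then pt (ω₂ (2 * N + 3 - i) 0 + 1) (ω₁ N 1 + ω₂ N 1 + 2 - ω₂ (2 * N + 3 - i) 1) else
  pt 0 (ω₁ N 1 + ω₂ N 1 + 2)

section glueValues
variable (N : ℕ) (ω₁ ω₂ : ℕ → Site 2)

/-- Value at `0`. [cite: MadrasSlade1993, §1.1] -/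
theorem glue_zero : glue N ω₁ ω₂ 0 = 0 := by simp [glue]
/-- Value at `1`. [cite: MadrasSlade1993, §1.1] -/
theorem glue_one : glue N ω₁ ω₂ 1 = pt 0 1 := by simp [glue]
/-- Values on the first block. [cite: MadrasSlade1993, §1.1] -/
theorem glue_of_block₁ {i : ℕ} (h1 : 2 ≤ i) (h2 : i ≤ N + 2) :
    glue N ω₁ ω₂ i = pt (ω₁ (i - 2) 0 + 1) (ω₁ (i - 2) 1 + 1) := by
  simp only [glue, if_neg (show i ≠ 0 by omega), if_neg (show i ≠ 1 by omega), if_pos h2]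
/-- Values on the second block. [cite: MadrasSlade1993, §1.1] -/
theorem glue_of_block₂ {i : ℕ} (h1 : N + 3 ≤ i) (h2 : i ≤ 2 * N + 3) :
    glue N ω₁ ω₂ i = pt (ω₂ (2 * N + 3 - i) 0 + 1) (ω₁ N 1 + ω₂ N 1 + 2 - ω₂ (2 * N + 3 - i) 1) := by
  simp only [glue, if_neg (show i ≠ 0 by omega), if_neg (show i ≠ 1 by omega), if_neg (show ¬ i ≤ N + 2 by omega), if_pos h2]
/-- The frozen end. [cite: MadrasSlade1993, §1.1] -/
theorem glue_of_end {i : ℕ} (h : 2 * N + 4 ≤ i) : glue N ω₁ ω₂ i = pt 0 (ω₁ N 1 + ω₂ N 1 + 2) := by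
  simp only [glue, if_neg (show i ≠ 0 by omega), if_neg (show i ≠ 1 by omega), if_neg (show ¬ i ≤ N + 2 by omega),
    if_neg (show ¬ i ≤ 2 * N + 3 by omega)]

end glueValues

/-- Coordinates of the glued arch, region by region: columns vanish exactly at the times `0, 1, 2N+4`; the first block lies in
the rows `≤ T₁ + 1`, the second in the rows `≥ T₁ + 2`. [cite: HammersleyTorrieWhittington1982, §2] -/
theorem glue_coords {h : ℤ} {ω₁ ω₂ : ℕ → Site 2} (h₁ : IsPiece N h ω₁) (h₂ : IsPiece N h ω₂) {i : ℕ} (hi : i ≤ 2 * N + 4) :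
    (i = 0 ∧ glue N ω₁ ω₂ i 0 = 0 ∧ glue N ω₁ ω₂ i 1 = 0) ∨ (i = 1 ∧ glue N ω₁ ω₂ i 0 = 0 ∧ glue N ω₁ ω₂ i 1 = 1) ∨
    (2 ≤ i ∧ i ≤ N + 2 ∧ 1 ≤ glue N ω₁ ω₂ i 0 ∧ glue N ω₁ ω₂ i 1 ≤ ω₁ N 1 + 1) ∨
    (N + 3 ≤ i ∧ i ≤ 2 * N + 3 ∧ 1 ≤ glue N ω₁ ω₂ i 0 ∧ ω₁ N 1 + 2 ≤ glue N ω₁ ω₂ i 1) ∨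
    (i = 2 * N + 4 ∧ glue N ω₁ ω₂ i 0 = 0 ∧ glue N ω₁ ω₂ i 1 = ω₁ N 1 + ω₂ N 1 + 2) := by
  obtain ⟨-, hq₁, -⟩ := h₁
  obtain ⟨-, hq₂, -⟩ := h₂
  rcases Nat.lt_or_ge i 2 with h2 | h2
  · rcases Nat.lt_or_ge i 1 with h1 | h1
    · obtain rfl : i = 0 := by omega
      exact Or.inl ⟨rfl, by rw [glue_zero]; rfl, by rw [glue_zero]; rfl⟩
    · obtain rfl : i = 1 := by omega
      exact Or.inr (Or.inl ⟨rfl, by rw [glue_one, pt_apply_zero], by rw [glue_one, pt_apply_one]⟩)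
  rcases Nat.lt_or_ge i (N + 3) with h3 | h3
  · refine Or.inr (Or.inr (Or.inl ⟨h2, by omega, ?_, ?_⟩))
    · rw [glue_of_block₁ N ω₁ ω₂ h2 (by omega), pt_apply_zero]; have := (hq₁ (i - 2) (by omega)).1; omega
    · rw [glue_of_block₁ N ω₁ ω₂ h2 (by omega), pt_apply_one]; have := (hq₁ (i - 2) (by omega)).2; omega
  rcases Nat.lt_or_ge i (2 * N + 4) with h4 | h4
  · refine Or.inr (Or.inr (Or.inr (Or.inl ⟨h3, by omega, ?_, ?_⟩)))
    · rw [glue_of_block₂ N ω₁ ω₂ h3 (by omega), pt_apply_zero]; have := (hq₂ (2 * N + 3 - i) (by omega)).1; omega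
    · rw [glue_of_block₂ N ω₁ ω₂ h3 (by omega), pt_apply_one]; have := (hq₂ (2 * N + 3 - i) (by omega)).2; omega
  · obtain rfl : i = 2 * N + 4 := by omega
    exact Or.inr (Or.inr (Or.inr (Or.inr ⟨rfl, by rw [glue_of_end N ω₁ ω₂ le_rfl, pt_apply_zero],
      by rw [glue_of_end N ω₁ ω₂ le_rfl, pt_apply_one]⟩)))

/-- **The glued walk is an arch with `2N + 4` steps** (two pieces with the same end column, `N` even).
[cite: HammersleyTorrieWhittington1982, §2 (terminally attached walks from pairs of unfolded walks); MadrasSlade1993, §8.2, proof of Theorem 8.2.1 (p. 269)] -/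
theorem glue_mem_arches {h : ℤ} {ω₁ ω₂ : ℕ → Site 2} (h₁ : IsPiece N h ω₁) (h₂ : IsPiece N h ω₂) (hN : N % 2 = 0) :
    glue N ω₁ ω₂ ∈ arches (2 * N + 4) := by
  have hc := fun i (hi : i ≤ 2 * N + 4) => glue_coords h₁ h₂ hi
  obtain ⟨hs₁, hq₁, he₁⟩ := h₁
  obtain ⟨hs₂, hq₂, he₂⟩ := h₂
  obtain ⟨h0₁, hend₁, hbw₁, hinj₁⟩ := mem_saws_iff.1 hs₁
  obtain ⟨h0₂, hend₂, hbw₂, hinj₂⟩ := mem_saws_iff.1 hs₂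
  have hpar₁ := parity_apply hs₁ le_rfl
  have hpar₂ := parity_apply hs₂ le_rfl
  have hNz : ((N : ℕ) : ℤ) % 2 = 0 := by exact_mod_cast hN
  have hT₁ : 0 ≤ ω₁ N 1 := by have := (hq₁ 0 (Nat.zero_le _)).2; rw [h0₁] at this; exact this
  have hT₂ : 0 ≤ ω₂ N 1 := by have := (hq₂ 0 (Nat.zero_le _)).2; rw [h0₂] at this; exact this
  set W := glue N ω₁ ω₂ with hW
  -- bonds
  have hBW : IsBW (2 * N + 4) W := by
    intro i hi
    rcases Nat.lt_or_ge i 2 with h2 | h2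
    · rcases Nat.lt_or_ge i 1 with h1 | h1
      · obtain rfl : i = 0 := by omega
        rw [hW, glue_zero, glue_one, zero_eq_pt]
        exact adj_pt_up (by decide)
      · obtain rfl : i = 1 := by omega
        rw [hW, glue_one, glue_of_block₁ N ω₁ ω₂ le_rfl (by omega), show 1 + 1 - 2 = 0 from rfl, h0₁]
        simpa using adj_pt_right 0 1
    rcases Nat.lt_or_ge i (N + 2) with h3 | h3
    · rw [hW, glue_of_block₁ N ω₁ ω₂ h2 (by omega), glue_of_block₁ N ω₁ ω₂ (by omega) (by omega),
        show i + 1 - 2 = i - 2 + 1 by omega]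
      exact adj_pt_shift (hbw₁ (i - 2) (by omega))
    rcases Nat.lt_or_ge i (N + 3) with h4 | h4
    · -- the junction: one vertical bond
      obtain rfl : i = N + 2 := by omega
      rw [hW, glue_of_block₁ N ω₁ ω₂ h2 le_rfl, glue_of_block₂ N ω₁ ω₂ le_rfl (by omega), Nat.add_sub_cancel,
        show 2 * N + 3 - (N + 2 + 1) = N by omega, he₁, he₂]
      have : pt (h + 1) (ω₁ N 1 + ω₂ N 1 + 2 - ω₂ N 1) = pt (h + 1) (ω₁ N 1 + 1 + 1) := by
        rw [site_two_eq_iff, pt_apply_zero, pt_apply_zero, pt_apply_one, pt_apply_one]; exact ⟨rfl, by omega⟩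
      rw [this]
      exact adj_pt_up (by rw [he₁] at hpar₁; omega)
    rcases Nat.lt_or_ge i (2 * N + 3) with h5 | h5
    · rw [hW, glue_of_block₂ N ω₁ ω₂ h4 (by omega), glue_of_block₂ N ω₁ ω₂ (by omega) (by omega),
        show 2 * N + 3 - i = 2 * N + 3 - (i + 1) + 1 by omega]
      have hr : (ω₁ N 1 + ω₂ N 1 + 2) % 2 = 0 := by rw [he₁] at hpar₁; rw [he₂] at hpar₂; omega
      exact (adj_pt_mirror hr (hbw₂ (2 * N + 3 - (i + 1)) (by omega))).symm
    · obtain rfl : i = 2 * N + 3 := by omega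
      rw [hW, glue_of_block₂ N ω₁ ω₂ h4 le_rfl, glue_of_end N ω₁ ω₂ le_rfl, Nat.sub_self, h0₂]
      simpa using adj_pt_left 0 (ω₁ N 1 + ω₂ N 1 + 2)
  -- injectivity
  have hkey : ∀ a b : ℕ, a ≤ 2 * N + 4 → b ≤ 2 * N + 4 → a < b → W a ≠ W b := by
    intro a b ha hb hab he
    have ha' := hc a ha
    have hb' := hc b hb
    have he0 := congrFun he 0
    have he1 := congrFun he 1
    -- same block cases use the injectivity of the pieces; all other cases differ in a coordinate
    rcases ha' with ⟨ra, ca, da⟩ | ⟨ra, ca, da⟩ | ⟨ra, ra', ca, da⟩ | ⟨ra, ra', ca, da⟩ | ⟨ra, ca, da⟩ <;>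
      rcases hb' with ⟨rb, cb, db⟩ | ⟨rb, cb, db⟩ | ⟨rb, rb', cb, db⟩ | ⟨rb, rb', cb, db⟩ | ⟨rb, cb, db⟩ <;>
      first
      | omega
      | (-- both in the first block
         rw [hW, glue_of_block₁ N ω₁ ω₂ ra ra', glue_of_block₁ N ω₁ ω₂ rb rb'] at he
         have : ω₁ (a - 2) = ω₁ (b - 2) := by
           rw [site_two_eq_iff] at he ⊢; simp only [pt_apply_zero, pt_apply_one] at he; omega
         have := hinj₁ (show a - 2 ∈ {i | i ≤ N} by simp; omega) (show b - 2 ∈ {i | i ≤ N} by simp; omega) this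
         omega)
      | (-- both in the second block
         rw [hW, glue_of_block₂ N ω₁ ω₂ ra ra', glue_of_block₂ N ω₁ ω₂ rb rb'] at he
         have : ω₂ (2 * N + 3 - a) = ω₂ (2 * N + 3 - b) := by
           rw [site_two_eq_iff] at he ⊢; simp only [pt_apply_zero, pt_apply_one] at he; omega
         have := hinj₂ (show 2 * N + 3 - a ∈ {i | i ≤ N} by simp; omega)
           (show 2 * N + 3 - b ∈ {i | i ≤ N} by simp; omega) this
         omega)
  have hinj : Set.InjOn W {i | i ≤ 2 * N + 4} := by
    intro a ha b hb he
    simp only [Set.mem_setOf_eq] at ha hb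
    rcases lt_trichotomy a b with hab | hab | hab
    · exact absurd he (hkey a b ha hb hab)
    · exact hab
    · exact absurd he.symm (hkey b a hb ha hab)
  have hsaws : W ∈ saws (2 * N + 4) :=
    mem_saws_iff.2 ⟨by rw [hW, glue_zero], fun i hi => by rw [hW, glue_of_end N ω₁ ω₂ hi, glue_of_end N ω₁ ω₂ le_rfl],
      hBW, hinj⟩
  refine mem_arches.2 ⟨mem_hp.2 ⟨hsaws, fun i hi => ?_⟩, by rw [hW, glue_of_end N ω₁ ω₂ le_rfl, pt_apply_zero]⟩
  rcases hc i hi with ⟨-, c, -⟩ | ⟨-, c, -⟩ | ⟨-, -, c, -⟩ | ⟨-, -, c, -⟩ | ⟨-, c, -⟩ <;> omega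

/-- **The glued arch visits the wall exactly three times** (at the times `0`, `1`, `2N + 4`).
[cite: HammersleyTorrieWhittington1982, §2; Beaton2014RotatedHoneycomb, §3.1 (arXiv v3 p. 11: "occupying m vertices in the surface")] -/
theorem visits_glue {h : ℤ} {ω₁ ω₂ : ℕ → Site 2} (h₁ : IsPiece N h ω₁) (h₂ : IsPiece N h ω₂) :
    visits (2 * N + 4) (glue N ω₁ ω₂) = 3 := by
  rw [visits_eq_card]
  have hset : (range (2 * N + 4 + 1)).filter (fun i => glue N ω₁ ω₂ i 0 = 0) = {0, 1, 2 * N + 4} := by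
    ext i
    simp only [Finset.mem_filter, Finset.mem_range, Finset.mem_insert, Finset.mem_singleton]
    constructor
    · rintro ⟨hi, h0⟩
      rcases glue_coords h₁ h₂ (show i ≤ 2 * N + 4 by omega) with
        ⟨r, -, -⟩ | ⟨r, -, -⟩ | ⟨-, -, c, -⟩ | ⟨-, -, c, -⟩ | ⟨r, -, -⟩ <;> omega
    · rintro (rfl | rfl | rfl)
      · exact ⟨by omega, by rw [glue_zero]; rfl⟩
      · exact ⟨by omega, by rw [glue_one, pt_apply_zero]⟩
      · exact ⟨by omega, by rw [glue_of_end N ω₁ ω₂ le_rfl, pt_apply_zero]⟩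
  rw [hset, Finset.card_eq_three]
  exact ⟨0, 1, 2 * N + 4, by omega, by omega, by omega, rfl⟩

/-- **The gluing is injective** on pairs of pieces. [cite: HammersleyTorrieWhittington1982, §2; MadrasSlade1993, §8.2, proof of Theorem 8.2.1 (p. 269)] -/
theorem glue_inj {h : ℤ} {ω₁ ω₂ ω₁' ω₂' : ℕ → Site 2} (h₁ : IsPiece N h ω₁) (h₂ : IsPiece N h ω₂) (h₁' : IsPiece N h ω₁')
    (h₂' : IsPiece N h ω₂') (he : glue N ω₁ ω₂ = glue N ω₁' ω₂') : ω₁ = ω₁' ∧ ω₂ = ω₂' := by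
  obtain ⟨hs₁, -, -⟩ := h₁
  obtain ⟨hs₂, -, -⟩ := h₂
  obtain ⟨hs₁', -, -⟩ := h₁'
  obtain ⟨hs₂', -, -⟩ := h₂'
  obtain ⟨-, hend₁, -, -⟩ := mem_saws_iff.1 hs₁
  obtain ⟨-, hend₂, -, -⟩ := mem_saws_iff.1 hs₂
  obtain ⟨-, hend₁', -, -⟩ := mem_saws_iff.1 hs₁'
  obtain ⟨-, hend₂', -, -⟩ := mem_saws_iff.1 hs₂'
  have hr := congrFun he (2 * N + 4)
  rw [glue_of_end N ω₁ ω₂ le_rfl, glue_of_end N ω₁' ω₂' le_rfl, site_two_eq_iff] at hr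
  simp only [pt_apply_zero, pt_apply_one] at hr
  have hA : ∀ i ≤ N, ω₁ i = ω₁' i := fun i hi => by
    have h1 := congrFun he (i + 2)
    rw [glue_of_block₁ N ω₁ ω₂ (by omega) (by omega), glue_of_block₁ N ω₁' ω₂' (by omega) (by omega),
      Nat.add_sub_cancel, site_two_eq_iff] at h1
    simp only [pt_apply_zero, pt_apply_one] at h1
    rw [site_two_eq_iff]; omega
  have hB : ∀ k ≤ N, ω₂ k = ω₂' k := fun k hk => by
    have h1 := congrFun he (2 * N + 3 - k)
    rw [glue_of_block₂ N ω₁ ω₂ (by omega) (by omega), glue_of_block₂ N ω₁' ω₂' (by omega) (by omega),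
      show 2 * N + 3 - (2 * N + 3 - k) = k by omega, site_two_eq_iff] at h1
    simp only [pt_apply_zero, pt_apply_one] at h1
    have hN1 := hA N le_rfl
    rw [site_two_eq_iff] at hN1
    rw [site_two_eq_iff]; omega
  constructor
  · funext i
    rcases Nat.lt_or_ge N i with hi | hi
    · rw [hend₁ i hi.le, hend₁' i hi.le]; exact hA N le_rfl
    · exact hA i hi
  · funext i
    rcases Nat.lt_or_ge N i with hi | hi
    · rw [hend₂ i hi.le, hend₂' i hi.le]; exact hB N le_rfl
    · exact hB i hi

/-- **`y³ · (#S)² ≤ A_{2N+4}(y)`** for a finite set `S` of pieces with a common end column (`N` even, `y > 0`): the glued arches are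
distinct and each carries the weight `y³`. [cite: HammersleyTorrieWhittington1982, §2; MadrasSlade1993, §8.2, proof of Theorem 8.2.1, eq. (8.2.14) (p. 269)] -/
theorem sq_le_Aw (hy : 0 < y) {h : ℤ} {S : Finset (ℕ → Site 2)} (hS : ∀ ω ∈ S, IsPiece N h ω) (hN : N % 2 = 0) :
    y ^ 3 * (#S : ℝ) ^ 2 ≤ Aw (2 * N + 4) y := by
  classical
  set P := (S ×ˢ S).image (fun p : (ℕ → Site 2) × (ℕ → Site 2) => glue N p.1 p.2) with hP
  have hinj : Set.InjOn (fun p : (ℕ → Site 2) × (ℕ → Site 2) => glue N p.1 p.2) ↑(S ×ˢ S) := by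
    rintro ⟨a, b⟩ hab ⟨a', b'⟩ hab' he
    simp only [Finset.coe_product, Set.mem_prod, Finset.mem_coe] at hab hab'
    obtain ⟨h1, h2⟩ := glue_inj (hS a hab.1) (hS b hab.2) (hS a' hab'.1) (hS b' hab'.2) he
    rw [h1, h2]
  have hcard : #P = #S * #S := by rw [hP, Finset.card_image_of_injOn hinj, Finset.card_product]
  have hsub : P ⊆ arches (2 * N + 4) := by
    intro W hW
    obtain ⟨⟨a, b⟩, hab, rfl⟩ := Finset.mem_image.1 hW
    obtain ⟨ha, hb⟩ := Finset.mem_product.1 hab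
    exact glue_mem_arches (hS a ha) (hS b hb) hN
  have hval : ∀ W ∈ P, y ^ visits (2 * N + 4) W = y ^ 3 := by
    intro W hW
    obtain ⟨⟨a, b⟩, hab, rfl⟩ := Finset.mem_image.1 hW
    obtain ⟨ha, hb⟩ := Finset.mem_product.1 hab
    rw [visits_glue (hS a ha) (hS b hb)]
  calc y ^ 3 * (#S : ℝ) ^ 2 = ∑ W ∈ P, y ^ visits (2 * N + 4) W := by
        rw [Finset.sum_congr rfl hval, Finset.sum_const, hcard, nsmul_eq_mul]; push_cast; ring
    _ ≤ Aw (2 * N + 4) y := Finset.sum_le_sum_of_subset_of_nonneg hsub fun _ _ _ => pow_nonneg hy.le _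


/-! ### (3) Column-unfolded up-walks are pieces; the best end-column fibre -/

open Classical in
/-- The column-unfolded re-based up-walks with `n` steps (pieces with `n + 2` steps).
[cite: MadrasSlade1993, §3.1 (Hammersley–Welsh unfolding) and §8.2, proof of Theorem 8.2.1 (p. 269)] -/
def unfUp (n : ℕ) : Finset (ℕ → Site 2) := ((upWalks n).image (liftUp n)).image (Wall.G (n + 2))

/-- Membership in `unfUp`. [cite: MadrasSlade1993, §3.1] -/
theorem mem_unfUp {ω : ℕ → Site 2} : ω ∈ unfUp n ↔ ∃ υ ∈ upWalks n, Wall.G (n + 2) (liftUp n υ) = ω := by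
  classical
  unfold unfUp
  constructor
  · intro h
    obtain ⟨v, hv, rfl⟩ := Finset.mem_image.1 h
    obtain ⟨υ, hυ, rfl⟩ := Finset.mem_image.1 hv
    exact ⟨υ, hυ, rfl⟩
  · rintro ⟨υ, hυ, rfl⟩
    exact Finset.mem_image.2 ⟨liftUp n υ, Finset.mem_image.2 ⟨υ, hυ, rfl⟩, rfl⟩

/-- **Unfolding costs at most `e^{6√(n+2)}`**: `#upWalks n ≤ e^{6√(n+2)} · #unfUp n` (`n` even).
[cite: MadrasSlade1993, §3.1, proof of Theorem 3.1.1 (the number of walks with a given unfolding is at most the number of codes); HammersleyTorrieWhittington1982, §2] -/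
theorem card_upWalks_le_exp_mul (hn : n % 2 = 0) :
    (#(upWalks n) : ℝ) ≤ Real.exp (6 * Real.sqrt (n + 2 : ℕ)) * #(unfUp n) := by
  classical
  have hsub : (upWalks n).image (liftUp n) ⊆ saws (n + 2) := by
    intro ω hω
    obtain ⟨υ, hυ, rfl⟩ := Finset.mem_image.1 hω
    exact (liftUp_mem_saws hυ).1
  have h1 : #((upWalks n).image (liftUp n)) = #(upWalks n) := Finset.card_image_of_injOn (liftUp_injOn n)
  have h2 := Wall.card_le_exp_mul_card_image_G hsub (show (n + 2) % 2 = 0 by omega)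
  rw [h1] at h2
  exact h2

/-- Every unfolded re-based up-walk is a piece with end column in `[0, n+2]`.
[cite: MadrasSlade1993, §3.1, proof of Theorem 3.1.1; HammersleyTorrieWhittington1982, §2 (unfolded walks)] -/
theorem isPiece_of_mem_unfUp (hn : n % 2 = 0) {ω : ℕ → Site 2} (hω : ω ∈ unfUp n) :
    IsPiece (n + 2) (ω (n + 2) 0) ω ∧ 0 ≤ ω (n + 2) 0 ∧ ω (n + 2) 0 ≤ ((n + 2 : ℕ) : ℤ) := by
  obtain ⟨υ, hυ, rfl⟩ := mem_unfUp.1 hω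
  obtain ⟨hs, hrows, -⟩ := liftUp_mem_saws hυ
  obtain ⟨hG, hwb, hY⟩ := Wall.G_spec hs (show (n + 2) % 2 = 0 by omega)
  obtain ⟨h0, -, hbw, -⟩ := mem_saws_iff.1 hG
  have h00 : Wall.G (n + 2) (liftUp n υ) 0 0 = 0 := by rw [h0]; rfl
  refine ⟨⟨hG, fun i hi => ⟨?_, ?_⟩, rfl⟩, ?_, ?_⟩
  · have := (hwb i hi).1; rwa [h00] at this
  · rw [hY i hi, hY (n + 2) le_rfl]; exact hrows i hi
  · have := (hwb (n + 2) le_rfl).1; rwa [h00] at this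
  · have := Zd.abs_apply_le_of_adj h0 (fun i hi => brickWallGraph_le (hbw i hi)) (n + 2) le_rfl 0
    exact (abs_le.1 this).2

/-- **Pigeonhole over the end column**: some fibre carries at least `#unfUp n / (n+3)` of the unfolded up-walks.
[cite: MadrasSlade1993, §8.2, proof of Theorem 8.2.1 (p. 269); HammersleyTorrieWhittington1982, §2] -/
theorem exists_fibre (hn : n % 2 = 0) :
    ∃ h : ℤ, (#(unfUp n) : ℝ) ≤ ((n + 3 : ℕ) : ℝ) * #((unfUp n).filter fun ω => ω (n + 2) 0 = h) := by
  classical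
  set W := unfUp n with hWdef
  set f : (ℕ → Site 2) → ℕ := fun ω => (ω (n + 2) 0).toNat with hf
  have hmaps : ∀ ω ∈ W, f ω ∈ range (n + 3) := fun ω hω => by
    obtain ⟨-, -, hle⟩ := isPiece_of_mem_unfUp hn hω
    have : (ω (n + 2) 0).toNat ≤ n + 2 := Int.toNat_le.2 hle
    rw [Finset.mem_range]; simp only [hf]; omega
  obtain ⟨k, -, hmax⟩ := Finset.exists_max_image (range (n + 3)) (fun k => #(W.filter fun ω => f ω = k)) ⟨0, by simp⟩
  refine ⟨(k : ℤ), ?_⟩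
  have hcard : #W = ∑ k' ∈ range (n + 3), #(W.filter fun ω => f ω = k') := Finset.card_eq_sum_card_fiberwise hmaps
  have hle : ∑ k' ∈ range (n + 3), #(W.filter fun ω => f ω = k') ≤ (n + 3) * #(W.filter fun ω => f ω = k) :=
    calc ∑ k' ∈ range (n + 3), #(W.filter fun ω => f ω = k')
        ≤ ∑ k' ∈ range (n + 3), #(W.filter fun ω => f ω = k) := Finset.sum_le_sum fun k' hk' => hmax k' hk'
      _ = (n + 3) * #(W.filter fun ω => f ω = k) := by rw [Finset.sum_const, Finset.card_range, smul_eq_mul]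
  have hfib : W.filter (fun ω => f ω = k) = W.filter (fun ω => ω (n + 2) 0 = (k : ℤ)) := by
    apply Finset.filter_congr
    intro ω hω
    obtain ⟨-, h0, -⟩ := isPiece_of_mem_unfUp hn hω
    simp only [hf]
    omega
  rw [← hfib]
  exact_mod_cast hcard ▸ hle

/-! ### (4) Subexponential factors lose against exponential growth -/

/-- `c √(2m+2) ≤ L m` eventually, for `L > 0`. [cite: MadrasSlade1993, §3.1 (e^{O(√n)} is subexponential)] -/
theorem eventually_sqrt_le_mul {c L : ℝ} (hL : 0 < L) : ∀ᶠ m : ℕ in atTop, c * Real.sqrt (2 * m + 2) ≤ L * m := by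
  rcases le_or_gt c 0 with hc | hc
  · exact Filter.Eventually.of_forall fun m =>
      (mul_nonpos_of_nonpos_of_nonneg hc (Real.sqrt_nonneg _)).trans (by positivity)
  · set D := (L / c) ^ 2 with hD
    have hD0 : 0 < D := by positivity
    refine Filter.eventually_atTop.2 ⟨⌈4 / D⌉₊ + 1, fun m hm => ?_⟩
    have hm1 : (1 : ℝ) ≤ m := by exact_mod_cast (show 1 ≤ m by omega)
    have hmD : 4 / D ≤ m := (Nat.le_ceil _).trans (by exact_mod_cast (show ⌈4 / D⌉₊ ≤ m by omega))
    have h4 : 4 ≤ D * m := by rwa [div_le_iff₀ hD0, mul_comm] at hmD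
    have hsq : (2 * m + 2 : ℝ) ≤ (L / c * m) ^ 2 := by
      have : (L / c * m) ^ 2 = D * m * m := by rw [hD]; ring
      rw [this]; nlinarith
    have hs : Real.sqrt (2 * m + 2) ≤ L / c * m := Real.sqrt_le_iff.2 ⟨by positivity, hsq⟩
    calc c * Real.sqrt (2 * m + 2) ≤ c * (L / c * m) := mul_le_mul_of_nonneg_left hs hc.le
      _ = L * m := by field_simp

/-- **Subexponential vs exponential**: for `0 ≤ a < 1`, `K ≥ 0` and any `c`, eventually
`K · exp(c√(2m+2))² · (2m+3)² · aᵐ < 1`. [cite: MadrasSlade1993, §3.1 (proof of Theorem 3.1.1: e^{O(√n)} factors do not change growth rates)] -/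
theorem eventually_subexp_mul_pow_lt_one {a K c : ℝ} (ha0 : 0 ≤ a) (ha1 : a < 1) (hK : 0 ≤ K) :
    ∀ᶠ m : ℕ in atTop, K * (Real.exp (c * Real.sqrt (2 * m + 2)) ^ 2 * (2 * (m : ℝ) + 3) ^ 2) * a ^ m < 1 := by
  rcases ha0.eq_or_lt with rfl | ha0'
  · refine Filter.eventually_atTop.2 ⟨1, fun m hm => ?_⟩
    rw [zero_pow (by omega), mul_zero]; exact zero_lt_one
  obtain ⟨b, hab, hb1⟩ := exists_between ha1
  have hb0 : 0 < b := ha0'.trans hab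
  -- (i) the stretched exponential against (b/a)^m
  have hlog : 0 < Real.log (b / a) := Real.log_pos ((one_lt_div ha0').2 hab)
  have h1 : ∀ᶠ m : ℕ in atTop, Real.exp (c * Real.sqrt (2 * m + 2)) ^ 2 * (a / b) ^ m ≤ 1 := by
    filter_upwards [eventually_sqrt_le_mul (c := 2 * c) hlog] with m hm
    have hab' : (a / b) ^ m = Real.exp (-(Real.log (b / a) * m)) := by
      rw [show b / a = (a / b)⁻¹ by rw [inv_div], Real.log_inv, neg_mul, neg_neg, mul_comm, Real.exp_nat_mul,
        Real.exp_log (div_pos ha0' hb0)]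
    rw [hab', ← Real.exp_nat_mul, ← Real.exp_add]
    simp only [Nat.cast_ofNat]
    rw [Real.exp_le_one_iff]  -- exp x ≤ 1 ↔ x ≤ 0
    linarith
  -- (ii) the polynomial against b^m
  have h2 : Tendsto (fun m : ℕ => K * (2 * (m : ℝ) + 3) ^ 2 * b ^ m) atTop (𝓝 0) := by
    have t2 := tendsto_pow_const_mul_const_pow_of_lt_one 2 hb0.le hb1
    have t1 := tendsto_pow_const_mul_const_pow_of_lt_one 1 hb0.le hb1
    have t0 := tendsto_pow_const_mul_const_pow_of_lt_one 0 hb0.le hb1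
    have := ((t2.const_mul (4 * K)).add (t1.const_mul (12 * K))).add (t0.const_mul (9 * K))
    simp only [mul_zero, add_zero] at this
    refine this.congr fun m => ?_
    simp only [pow_one, pow_zero, one_mul]
    ring
  have h2' : ∀ᶠ m : ℕ in atTop, K * (2 * (m : ℝ) + 3) ^ 2 * b ^ m < 1 := h2.eventually (gt_mem_nhds zero_lt_one)
  filter_upwards [h1, h2'] with m hm1 hm2
  have hsplit : K * (Real.exp (c * Real.sqrt (2 * m + 2)) ^ 2 * (2 * (m : ℝ) + 3) ^ 2) * a ^ m =
      (Real.exp (c * Real.sqrt (2 * m + 2)) ^ 2 * (a / b) ^ m) * (K * (2 * (m : ℝ) + 3) ^ 2 * b ^ m) := by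
    rw [div_pow]; field_simp
  rw [hsplit]
  calc _ ≤ 1 * (K * (2 * (m : ℝ) + 3) ^ 2 * b ^ m) := mul_le_mul_of_nonneg_right hm1 (by positivity)
    _ < 1 := by rw [one_mul]; exact hm2

/-! ### (5) The wall-bridge rate dominates the connective constant -/

/-- **`μ ≤ β_rot(y)` for every `y > 0`, given the face `ArchBound y`** (discharged by the fixed-length unfolding,
`HexSAWArmchairUnfolding.lean`): the armchair wall bridges — Beaton's unfolded walks, terminally attached — have the full
connective constant as soon as `y > 0`.  With `rotSurfaceMu y = max (armRate y) μ` this identifies Beaton's `μ(y)` with the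
wall-bridge rate itself: "`μ(y) = lim U_n^+(y)^{1/n}`".
[cite: HammersleyTorrieWhittington1982, §2; Beaton2014RotatedHoneycomb, §3.1, proof of Proposition 7 (arXiv v3 p. 12); MadrasSlade1993, §8.2, proof of Theorem 8.2.1 (p. 269); DuminilCopinSmirnov2012, Theorem 1] -/
theorem hexConnectiveConstant_le_armRate_of_archBound (hy : 0 < y) (hA : ArchBound y) :
    hexConnectiveConstant ≤ armRate y := by
  refine le_of_not_gt fun hlt => ?_
  obtain ⟨r, hr1, hr2⟩ := exists_between hlt
  obtain ⟨τ, hτ1, hτ2⟩ := exists_between hr2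
  have hr0 : 0 < r := (armRate_pos y).trans hr1
  have hτ0 : 0 < τ := hr0.trans hτ1
  obtain ⟨C, hC⟩ := hA r hr1
  have hC0 : 0 ≤ C := by
    have := hC 0
    rw [pow_zero, mul_one] at this
    exact (Aw_nonneg 0 hy.le).trans this
  -- the squeeze at the lengths 2m (up-walks) ↦ 4m + 8 (arches)
  have hmain : ∀ m : ℕ, τ ^ (2 * m) ≤ (hvBridgeLen (2 * m) : ℝ) →
      y ^ 3 * τ ^ (4 * m) ≤ Real.exp (6 * Real.sqrt (2 * m + 2)) ^ 2 * (2 * (m : ℝ) + 3) ^ 2 * (C * r ^ (4 * m + 8)) := by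
    intro m hm
    have hn : (2 * m) % 2 = 0 := by omega
    obtain ⟨h, hfib⟩ := exists_fibre hn
    set S := (unfUp (2 * m)).filter fun ω => ω (2 * m + 2) 0 = h with hSdef
    have hS : ∀ ω ∈ S, IsPiece (2 * m + 2) h ω := fun ω hω => by
      obtain ⟨hω, hh⟩ := Finset.mem_filter.1 hω
      have := (isPiece_of_mem_unfUp hn hω).1
      rwa [hh] at this
    have h1 : y ^ 3 * (#S : ℝ) ^ 2 ≤ Aw (2 * (2 * m + 2) + 4) y := sq_le_Aw hy hS (by omega)
    have h2 : Aw (2 * (2 * m + 2) + 4) y ≤ C * r ^ (4 * m + 8) :=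
      (hC _).trans (by rw [show 2 * (2 * m + 2) + 4 = 4 * m + 8 by ring])
    have h3 : τ ^ (2 * m) ≤ Real.exp (6 * Real.sqrt (2 * m + 2)) * ((2 * (m : ℝ) + 3) * #S) :=
      calc τ ^ (2 * m) ≤ hvBridgeLen (2 * m) := hm
        _ ≤ #(upWalks (2 * m)) := by exact_mod_cast hvBridgeLen_le_card_upWalks (2 * m)
        _ ≤ Real.exp (6 * Real.sqrt ((2 * m + 2 : ℕ) : ℝ)) * #(unfUp (2 * m)) := card_upWalks_le_exp_mul hn
        _ ≤ Real.exp (6 * Real.sqrt ((2 * m + 2 : ℕ) : ℝ)) * (((2 * m + 3 : ℕ) : ℝ) * #S) :=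
            mul_le_mul_of_nonneg_left hfib (Real.exp_pos _).le
        _ = _ := by push_cast; ring_nf
    have h4 : (τ ^ (2 * m)) ^ 2 ≤ (Real.exp (6 * Real.sqrt (2 * m + 2)) * ((2 * (m : ℝ) + 3) * #S)) ^ 2 :=
      pow_le_pow_left₀ (pow_nonneg hτ0.le _) h3 2
    calc y ^ 3 * τ ^ (4 * m) = y ^ 3 * (τ ^ (2 * m)) ^ 2 := by ring
      _ ≤ y ^ 3 * (Real.exp (6 * Real.sqrt (2 * m + 2)) * ((2 * (m : ℝ) + 3) * #S)) ^ 2 :=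
          mul_le_mul_of_nonneg_left h4 (pow_nonneg hy.le 3)
      _ = Real.exp (6 * Real.sqrt (2 * m + 2)) ^ 2 * (2 * (m : ℝ) + 3) ^ 2 * (y ^ 3 * (#S : ℝ) ^ 2) := by ring
      _ ≤ _ := mul_le_mul_of_nonneg_left (h1.trans h2) (by positivity)
  -- the other way: the right-hand side is eventually SMALLER (τ > r)
  have hup : ∀ᶠ m : ℕ in atTop,
      Real.exp (6 * Real.sqrt (2 * m + 2)) ^ 2 * (2 * (m : ℝ) + 3) ^ 2 * (C * r ^ (4 * m + 8)) < y ^ 3 * τ ^ (4 * m) := by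
    have ha0 : 0 ≤ (r / τ) ^ 4 := by positivity
    have ha1 : (r / τ) ^ 4 < 1 := pow_lt_one₀ (by positivity) ((div_lt_one hτ0).2 hτ1) (by norm_num)
    have hK : 0 ≤ C * r ^ 8 / y ^ 3 := by positivity
    filter_upwards [eventually_subexp_mul_pow_lt_one (c := 6) ha0 ha1 hK] with m hm
    have hid : Real.exp (6 * Real.sqrt (2 * m + 2)) ^ 2 * (2 * (m : ℝ) + 3) ^ 2 * (C * r ^ (4 * m + 8)) =
        (C * r ^ 8 / y ^ 3 * (Real.exp (6 * Real.sqrt (2 * m + 2)) ^ 2 * (2 * (m : ℝ) + 3) ^ 2) * ((r / τ) ^ 4) ^ m) *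
          (y ^ 3 * τ ^ (4 * m)) := by
      have hτne : τ ≠ 0 := hτ0.ne'
      have hyne : y ≠ 0 := hy.ne'
      rw [← pow_mul, div_pow, show r ^ (4 * m + 8) = r ^ 8 * r ^ (4 * m) by ring]
      field_simp
    rw [hid]
    exact mul_lt_of_lt_one_left (by positivity) hm
  obtain ⟨m, hm1, hm2⟩ := ((HV.eventually_pow_le_hvBridgeLen hτ0 hτ2).and hup).exists
  exact absurd (hmain m hm1) (not_le.2 hm2)

/-- Hence, given the face, `max (β_rot(y), μ) = β_rot(y)`: Beaton's `μ(y)` IS the wall-bridge rate.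
[cite: Beaton2014RotatedHoneycomb, §3.1, proof of Proposition 7 (arXiv v3 p. 12: "μ(y) = lim U_n^+(y)^{1/n}"); HammersleyTorrieWhittington1982, §2] -/
theorem max_armRate_eq_of_archBound (hy : 0 < y) (hA : ArchBound y) :
    max (armRate y) hexConnectiveConstant = armRate y :=
  max_eq_left (hexConnectiveConstant_le_armRate_of_archBound hy hA)

end Literature.Probability.RandomPlanarGeometry.SAW.HexBW.Arm
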